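import Mathlib
import Summits.Ventures.PercRepro2.WeightedRows
import Summits.Ventures.PercRepro2.TypedRowMin

/-!
# The edge-class split of (ROW-MIN) and (W-ROW-MIN): two non-disjunctive rows
(blind cell PercRepro2, night-3 g20, 2026-08-28; `proofs/NIGHT3-CERT.md` §29)

Read off the data (typed: exhaustive `(u, a) ∈ {(0,4), (1,4), (0,5)}`, 20,487 nonzero rows along
type-`1` edges, marks distinct; weighted: random, this seat): along a type-`1` edge `g`,

* if `g` touches a ROOT or `a₃` (`a₁ ∈ g ∨ a₂ ∈ g ∨ a₃ ∈ g`), the type-`1` base dominates the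
  CONTRACTION, `N₁ ≥ N₃` — and `N₁ < N₀` happens there;
* otherwise (`g` among `o`, `b` and the unmarked vertices) it dominates the DELETION, `N₁ ≥ N₀` —
  and `N₁ < N₃` happens there.

So the disjunctive (ROW-MIN) / (W-ROW-MIN) split into two candidates without a disjunction
(`RowMinR`, `RowMinF`; `WRowMinR`, `WRowMinF` — all `def`s, NOT claimed proved), each implying
its half of the `min`: `rowMin_of_split`, `wrowMin_of_split`, and the crux from (W-ROW-23) with
the two halves (`HCov_of_wrow23_split`). Mechanism read: opening an edge at a root or at `a₃` can
kill `Q` or `PD`, so the contraction is the small side; elsewhere opening only enlarges clusters.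
Own work; standard axioms.
-/

namespace Summit.Ventures.PercRepro2

open UnionCluster

namespace CovForm

section Split

variable {V : Type*} {E : Type*} [Fintype E] [DecidableEq E] {R : Type*} [Field R]
  [LinearOrder R] [IsStrictOrderedRing R]

/-- The edge touches a root or `a₃`. -/
def TouchesRoots (ends : E → Sym2 V) (a₁ a₂ a₃ : V) (e : E) : Prop :=
  a₁ ∈ ends e ∨ a₂ ∈ ends e ∨ a₃ ∈ ends e

/-- **(ROW-MIN-R), a CANDIDATE (not claimed proved)**: at a type-`1` edge touching a root or `a₃`
the typed base dominates the contraction (`g` pinned open). -/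
def RowMinR (ends : E → Sym2 V) (o a₁ a₂ a₃ b : V) : Prop :=
  ∀ (F : Finset E) (z : Config E) (τ : E → ℕ) (g : E), g ∈ F → τ g = 1 →
    (∀ e ∈ F, τ e = 1 ∨ τ e = 2) → TouchesRoots ends a₁ a₂ a₃ g →
    typedCount F z (Function.update τ g 3)
        (K3 ends o a₁ a₂ a₃ b : Config E → Config E → Config E → R) ≤
      typedCount F z τ (K3 ends o a₁ a₂ a₃ b)

/-- **(ROW-MIN-F), a CANDIDATE (not claimed proved)**: at a type-`1` edge touching neither root nor
`a₃` the typed base dominates the deletion (`g` pinned closed). -/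
def RowMinF (ends : E → Sym2 V) (o a₁ a₂ a₃ b : V) : Prop :=
  ∀ (F : Finset E) (z : Config E) (τ : E → ℕ) (g : E), g ∈ F → τ g = 1 →
    (∀ e ∈ F, τ e = 1 ∨ τ e = 2) → ¬ TouchesRoots ends a₁ a₂ a₃ g →
    typedCount F z (Function.update τ g 0)
        (K3 ends o a₁ a₂ a₃ b : Config E → Config E → Config E → R) ≤
      typedCount F z τ (K3 ends o a₁ a₂ a₃ b)

omit [IsStrictOrderedRing R] in
/-- The two halves give (ROW-MIN). -/
theorem rowMin_of_split (ends : E → Sym2 V) (o a₁ a₂ a₃ b : V)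
    (hR : RowMinR (R := R) ends o a₁ a₂ a₃ b) (hF : RowMinF (R := R) ends o a₁ a₂ a₃ b) :
    RowMin (R := R) ends o a₁ a₂ a₃ b := by
  intro F z τ g hg hg1 hτ
  by_cases ht : TouchesRoots ends a₁ a₂ a₃ g
  · exact Or.inr (hR F z τ g hg hg1 hτ ht)
  · exact Or.inl (hF F z τ g hg hg1 hτ ht)

/-- **(W-ROW-MIN-R), a CANDIDATE (not claimed proved)**: at an edge touching a root or `a₃`, the
one-typed-edge (type `1`) sum dominates `p_e (1 − p_e)²` times the cubic form of the contraction. -/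
def WRowMinR (ends : E → Sym2 V) (o a₁ a₂ a₃ b : V) : Prop :=
  ∀ (p : E → R), IsProbVec p → ∀ (e : E) (τ : E → ℕ), TouchesRoots ends a₁ a₂ a₃ e →
    p e * (1 - p e) ^ 2 * Gc (Function.update p e 1) ends o a₁ a₂ a₃ b ≤
      triSum p {e} (Function.update τ e 1) (K3 ends o a₁ a₂ a₃ b)

/-- **(W-ROW-MIN-F), a CANDIDATE (not claimed proved)**: at an edge touching neither root nor
`a₃`, the one-typed-edge (type `1`) sum dominates `p_e (1 − p_e)²` times the cubic form of the
deletion. -/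
def WRowMinF (ends : E → Sym2 V) (o a₁ a₂ a₃ b : V) : Prop :=
  ∀ (p : E → R), IsProbVec p → ∀ (e : E) (τ : E → ℕ), ¬ TouchesRoots ends a₁ a₂ a₃ e →
    p e * (1 - p e) ^ 2 * Gc (Function.update p e 0) ends o a₁ a₂ a₃ b ≤
      triSum p {e} (Function.update τ e 1) (K3 ends o a₁ a₂ a₃ b)

omit [IsStrictOrderedRing R] in
/-- The two halves give (W-ROW-MIN). -/
theorem wrowMin_of_split (ends : E → Sym2 V) (o a₁ a₂ a₃ b : V)
    (hR : WRowMinR (R := R) ends o a₁ a₂ a₃ b) (hF : WRowMinF (R := R) ends o a₁ a₂ a₃ b) :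
    WRowMin (R := R) ends o a₁ a₂ a₃ b := by
  intro p hp e τ
  by_cases ht : TouchesRoots ends a₁ a₂ a₃ e
  · exact Or.inr (hR p hp e τ ht)
  · exact Or.inl (hF p hp e τ ht)

/-- **(HCOV) from (W-ROW-23) and the two halves of (W-ROW-MIN)**, for every admissible weight
vector. -/
theorem HCov_of_wrow23_split (ends : E → Sym2 V) (o a₁ a₂ a₃ b : V)
    (h23 : WRow23 (R := R) ends o a₁ a₂ a₃ b) (hR : WRowMinR (R := R) ends o a₁ a₂ a₃ b)
    (hF : WRowMinF (R := R) ends o a₁ a₂ a₃ b) (p : E → R) (hp : IsProbVec p) :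
    HCov p ends o a₁ a₂ a₃ b :=
  WRows.HCov_of_wrows ends o a₁ a₂ a₃ b h23 (wrowMin_of_split ends o a₁ a₂ a₃ b hR hF) p hp

end Split

end CovForm

end Summit.Ventures.PercRepro2
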